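import Literature.AlgebraicGeometry.Resolution.OrderReductionThreefoldsAlgClosed
import Literature.AlgebraicGeometry.Resolution.IdealisticExponentResolution
import HarnessLib

/-!
# (ʳ-fine) — INSERTION-STABLE marked order reduction on regular excellent threefolds (TYPED SIGNATURE ONLY; OURS; counted 0) — **rev 3: BOTH PROPS REFUTED AS TYPED**

**ERRATUM (rev 3, res-B-lens-2 gen 6, 2026-08-29T01:46Z).** `InsertionStableMarkedOrderReductionThree` and `InsertionStableOrderReductionThreeCodimTwo` are
FALSE as stated, in every characteristic: the monomial-phase insertion loop of `Lines/giraud-weak-normal-form-RFINE-loop.md` — initial state `X = 𝔸³_k`,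
`E = []`, `J = (y^μ, u₁^μ u₂^μ)` (normalised; `V(J)` of codimension 2), `supp = V(y,u₁) ∪ V(y,u₂)`; against EVERY rule `ρ` the play «insert at the
transversal crossing point of two heavy `Σ_μ`-curves whenever `ρ` proposes one of them, then accept» keeps two adjacent heavy curves forever (chart
computation: the new exceptional line gets exponent `c₁ + c₂ − μ ≥ μ`, [CossartPiltant2008, Lemma 4.3 (5)]; accepting lowers one exponent by `μ`), with
≤ 1 insertion per ACCEPT, all centres admissible, all supports nonempty — so hypothesis (T) has an infinite legal play and both `Prop`s below are false
(the sanity theorems and `of_marked` remain correct and now vacuous). The statements are LEFT VERBATIM as the record of what was proposed and refuted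
(nothing was ever asserted; no skeleton cites them); do NOT register either name as a stub. The characteristic-free mechanism is the known
order-sensitivity of the monomial case [Kollar2007, 3.111 Step 3 and (3.112)]: all divisors with coefficient `≥ m` must be blown up BEFORE any pairwise
intersection. What survives is recorded in the loop note §5: no context-free shared termination stub exists; termination must stay coupled to the
customer's insertion predicate with its own monotone datum (F-71ᴱ + that datum then suffice).

Unit res-B-lens-2 gen 5 (planner), crux `stmt-ResolutionOfSingularities-0549` (`Theses.Descent.DescentPerfectToAll`), line
`giraud-weak-normal-form`; companion note `Lines/giraud-weak-normal-form-RFINE.md` (rev 1.3; this file rev 2 = + integral centres (s1) + the X44c-minimal variant `InsertionStableOrderReductionThreeCodimTwo` with `of_marked` (s2); statement G/G′/G″/G‴, the necessity of the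
bounded-insertion hypothesis, print status, CLAIM-0). Written at the REGISTRAR's request (bus 2026-08-29T01:03:57Z: «lens-2/princ3 supply the
signature; the lead decides where it is registered — natural home the 15917 CleanModels skeleton, consumed BY NAME by lens-2's (ʳ-fine)»).
bears_on: LADDER-RESOLUTION:B · [OURS · CANDIDATE] counted 0; nothing here proves resolution in char p.
**Resolution of singularities in positive characteristic is NOT proved here or anywhere in this line.** Nothing is asserted in this file:
`InsertionStableMarkedOrderReductionThree` is a `Prop` (a candidate SHARED STUB statement), not a theorem; no skeleton is registered by this
file (lens seats never run `ledger skeleton check` on 0549).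

THE STATEMENT (form G′ of the note = «pending centre» protocol, well-posed by CLAIM-0 ✓; the currency is the tree's BGMW `MarkedIdeal` /
`MarkedIdeal.transform` / `strictTransformIdeal` / `HasSNCWith` / `IsBlowup`, exactly as in `Cutkosky2009_thm_5_6` and F-71ᴱ
`MarkedOrderReductionExcellentThreefolds`). There is a RULE `ρ` assigning a centre to every marked ideal on every scheme such that
(R) on every integral Noetherian regular excellent scheme of dimension `3` and every max-order-normalised marked ideal `(I, E, r)` (`E` snc,
`I ≠ ⊥`, `1 ≤ r`, `ν_x(I) ≤ r` everywhere) with NONEMPTY support, `ρ` proposes an ADMISSIBLE centre (regular, inside the support, snc with `E`);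
(T) there is NO INFINITE PLAY of the following protocol starting from such a state: a pending centre `P n` is maintained; `P 0 = ρ(X₀, M₀)`;
at an ACCEPT step the pending centre is blown up (`C n = P n`) and the rule is consulted afresh on the transform (`P (n+1) = ρ(X_{n+1}, M_{n+1})`);
at an INSERT step a closed point `x n` of `V(P n) ∩ supp M_n` is blown up (`C n` = the reduced point) and the pending centre becomes the strict
transform of `P n`; every step is a blow-up `IsBlowup (π n) (C n)` with admissible centre and `M_{n+1} = M_n.transform (π n) (C n)`; all supports
are nonempty; and ACCEPT steps occur infinitely often (= only finitely many CONSECUTIVE insertions per pending centre — NECESSARY: the note's §3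
loop `J = (y^p + u₁u₂^p)`, `μ = p`, shows unbounded insertion defeats every rule).
Both customers instantiate it on EQUICHARACTERISTIC threefolds (crit-1 TRIAGE 28 F1); the mixed-characteristic instances are not needed and a
prover may add that binder. Insertions are automatically admissible (a reduced closed point of the support; snc with any snc boundary) and
CLAIM-0 (note §6) shows the pending strict transform stays admissible, so the admissibility hypotheses below only exclude junk chains.
CONSUMER OBLIGATIONS (true, standard, to be proved by whoever instantiates (T)): the normalised-state property is PRESERVED along admissible
blow-ups (regular excellent integral Noetherian of dimension 3 persists; `E'` snc by `MarkedIdeal.transform`; `I' ≠ ⊥`; `ν_x(I') ≤ r` at points over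
the centre when `r` = max order — [Kollar2007, 3.58–3.60] / [Cutkosky2009, §5]) so that (R) applies at every ACCEPT stage, and CLAIM-0 for
the INSERT stages; (T) is stated with these as hypotheses on the chain precisely so that the stub itself carries only the termination content.

PRINT STATUS: not in print — [CossartPiltant2008, §4 rules 1–4, p. 10] and [Cutkosky2009, §8] allow point blow-ups on `Σ`-curves only at
singular / non-transversal / intersection points; the characteristic-zero model of the surrounding mechanism is [Kollar2007, Thm. 3.107,
3.109–3.111] (functorial, hence insertion-free). Expected kernel size L. HONEST STATUS: AI-written, weaker than expert review; a typed target.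
[cite: CossartPiltant2008, Prop. 4.4, Lemma 4.3 (5), Lemma 4.5] [cite: Cutkosky2009, Thm. 5.6, §8] [cite: Kollar2007, Thm. 3.107]
[cite: BierstoneGrigorievMilmanWlodarczyk2011, Def. 3.1.1–3.1.4]
-/

-- `Summit.<Summit>.<Sub>.…` with `Sub = Summit` (single-conjunct summit, D-0017)
set_option linter.dupNamespace false

noncomputable section

open CategoryTheory AlgebraicGeometry TopologicalSpace

namespace Summit.ResolutionOfSingularities.ResolutionOfSingularities.Cruxes.DescentPerfectToAll.GiraudWeakNormalForm

open Literature.AlgebraicGeometry.Resolution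

universe u

/-- A centre `C` is ADMISSIBLE for the marked ideal `M` (BGMW Def. 3.1.3 (1)–(2), the hypotheses of `IsMultipleBlowup.blowup`, PLUS
integrality so that every step is also an `IsPermissibleSeq.cons` of [CossartPiltant2008] — rev 2, seam (s1); harmless: a regular centre is the
disjoint union of its integral components, blown up one at a time): `V(C)` is a regular INTEGRAL scheme, lies inside `supp M`, and has simple
normal crossings with the boundary of `M`.
[cite: BierstoneGrigorievMilmanWlodarczyk2011, Def. 3.1.3] -/
def AdmissibleCentre {X : Scheme.{u}} (M : MarkedIdeal X) (C : X.IdealSheafData) : Prop :=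
  Scheme.IsRegular C.subscheme ∧ IsIntegral C.subscheme ∧ (C.support : Set X) ⊆ M.support ∧
    HasSNCWith M.boundary C

/-- A max-order-normalised marked-ideal STATE on a regular excellent integral Noetherian threefold (the input shape of
`Cutkosky2009_thm_5_6` / F-71ᴱ): `E` snc, `I ≠ ⊥`, `1 ≤ r`, `ν_x(I) ≤ r` for all `x`. [cite: Cutkosky2009, Def. 5.4, Def. 5.5] -/
def IsNormalisedThreefoldState (X : Scheme.{u}) (M : MarkedIdeal X) : Prop :=
  Nonempty (IsIntegral X) ∧ Nonempty (IsNoetherian X) ∧ Scheme.IsRegular X ∧ Scheme.IsExcellent X ∧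
    topologicalKrullDim X = 3 ∧ HasSNC M.boundary ∧ M.ideal ≠ ⊥ ∧ 1 ≤ M.mult ∧
    ∀ x : X, idealOrder M.ideal x ≤ M.mult

/-- **REFUTED AS TYPED (rev 3; `Lines/giraud-weak-normal-form-RFINE-loop.md`: the monomial-phase insertion loop `J = (y^μ, u₁^μ u₂^μ)` defeats
every rule `ρ` with ≤ 1 insertion per accept) — kept verbatim as the record; do not register.**
**(ʳ-fine) — `InsertionStableMarkedOrderReductionThree` (typed; OURS; nothing asserted; WAS the candidate SHARED STUB for lens-2's (ʳ-fine)
and the CleanModels side's X_perm / L7c).** There is a choice rule `ρ` for centres of marked ideals which (R) proposes admissible centres on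
normalised threefold states with nonempty support and (T) admits NO infinite play of the «pending centre» protocol with infinitely many
ACCEPT steps (see the module docstring for the protocol and `Lines/giraud-weak-normal-form-RFINE.md` for why the accept-infinitely-often
hypothesis is necessary). [cite: CossartPiltant2008, Prop. 4.4] [cite: Kollar2007, Thm. 3.107] -/
def InsertionStableMarkedOrderReductionThree : Prop :=
  ∃ ρ : ∀ (X : Scheme.{u}), MarkedIdeal X → X.IdealSheafData,
    -- (R) the rule proposes admissible centres on normalised threefold states with nonempty support
    (∀ (X : Scheme.{u}) (M : MarkedIdeal X), IsNormalisedThreefoldState X M → M.support.Nonempty →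
        AdmissibleCentre M (ρ X M)) ∧
    -- (T) no infinite protocol play with infinitely many ACCEPT steps
    ∀ (Xs : ℕ → Scheme.{u}) (Ms : ∀ n, MarkedIdeal (Xs n)) (π : ∀ n, Xs (n + 1) ⟶ Xs n)
      (C : ∀ n, (Xs n).IdealSheafData) (P : ∀ n, (Xs n).IdealSheafData) (x : ∀ n, Xs n) (acc : ℕ → Prop),
      IsNormalisedThreefoldState (Xs 0) (Ms 0) →
      (∀ n, (Ms n).support.Nonempty) →
      P 0 = ρ (Xs 0) (Ms 0) →
      (∀ n, IsBlowup (π n) (C n)) →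
      (∀ n, AdmissibleCentre (Ms n) (C n)) →
      (∀ n, Ms (n + 1) = (Ms n).transform (π n) (C n)) →
      -- ACCEPT steps: blow up the pending centre, then consult the rule afresh
      (∀ n, acc n → C n = P n ∧ P (n + 1) = ρ (Xs (n + 1)) (Ms (n + 1))) →
      -- INSERT steps: blow up a closed point of `V(P n) ∩ supp M_n`; the pending centre becomes the strict transform of `P n`
      (∀ n, ¬ acc n →
          IsClosed ({x n} : Set (Xs n)) ∧ x n ∈ (P n).support ∧ x n ∈ (Ms n).support ∧
          ((C n).support : Set (Xs n)) = {x n} ∧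
          P (n + 1) = strictTransformIdeal (π n) (C n) (P n)) →
      -- bounded insertion: ACCEPT steps occur infinitely often
      (∀ n, ∃ m, n ≤ m ∧ acc m) →
      False

namespace InsertionStableMarkedOrderReductionThree

/-- SANITY (the two clauses are used as intended): from (ʳ-fine), a rule as in (R) exists — the projection a consumer uses first to START a
play (it then alternates its own insertions with ACCEPT steps and invokes (T) to see the play end with empty support). [folklore] -/
theorem exists_admissible_rule (h : InsertionStableMarkedOrderReductionThree.{u}) :
    ∃ ρ : ∀ (X : Scheme.{u}), MarkedIdeal X → X.IdealSheafData,
      ∀ (X : Scheme.{u}) (M : MarkedIdeal X), IsNormalisedThreefoldState X M → M.support.Nonempty →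
        AdmissibleCentre M (ρ X M) := by
  obtain ⟨ρ, hR, -⟩ := h
  exact ⟨ρ, hR⟩

/-- SANITY (shape of (T) as a consumer meets it): a play in which EVERY step is an ACCEPT step (no insertions at all — the F-71ᴱ regime)
cannot be infinite with all supports nonempty. [folklore] -/
theorem no_infinite_acceptOnly_play (h : InsertionStableMarkedOrderReductionThree.{u})
    : ∃ ρ : ∀ (X : Scheme.{u}), MarkedIdeal X → X.IdealSheafData,
      (∀ (X : Scheme.{u}) (M : MarkedIdeal X), IsNormalisedThreefoldState X M → M.support.Nonempty →
        AdmissibleCentre M (ρ X M)) ∧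
      ∀ (Xs : ℕ → Scheme.{u}) (Ms : ∀ n, MarkedIdeal (Xs n)) (π : ∀ n, Xs (n + 1) ⟶ Xs n),
        IsNormalisedThreefoldState (Xs 0) (Ms 0) →
        (∀ n, (Ms n).support.Nonempty) →
        (∀ n, IsBlowup (π n) (ρ (Xs n) (Ms n))) →
        (∀ n, AdmissibleCentre (Ms n) (ρ (Xs n) (Ms n))) →
        (∀ n, Ms (n + 1) = (Ms n).transform (π n) (ρ (Xs n) (Ms n))) →
        False := by
  obtain ⟨ρ, hR, hT⟩ := h
  refine ⟨ρ, hR, fun Xs Ms π h0 hne hbl hadm htr => ?_⟩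
  have hx : ∀ n, (Ms n).support.Nonempty := hne
  choose x hxmem using hx
  exact hT Xs Ms π (fun n => ρ (Xs n) (Ms n)) (fun n => ρ (Xs n) (Ms n)) x (fun _ => True) h0 hne rfl hbl hadm htr
    (fun n _ => ⟨rfl, rfl⟩) (fun n hn => (hn trivial).elim) (fun n => ⟨n, le_rfl, trivial⟩)

end InsertionStableMarkedOrderReductionThree

/-- The X44c-MINIMAL state (rev 2, seam (s2)): a normalised threefold state whose ideal has cosupport of codimension `≥ 2`
(the `hcodim` binder of F-71 / `CossartPiltant2008_prop44` and of X44c). [cite: CossartPiltant2008, Prop. 4.4] -/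
def IsNormalisedThreefoldStateCodimTwo (X : Scheme.{u}) (M : MarkedIdeal X) : Prop :=
  IsNormalisedThreefoldState X M ∧ ∀ x ∈ M.ideal.support, 1 < Order.coheight x

/-- **REFUTED AS TYPED (rev 3; same loop — its initial state has `V(J)` of codimension 2, so the extra binder holds) — kept verbatim as the record;
do not register.** **`InsertionStableOrderReductionThreeCodimTwo` (typed; OURS; nothing asserted) — the X44c-minimal cut of (ʳ-fine):** the same
«pending centre» protocol statement with the initial state required to have cosupport of codimension `≥ 2` (no divisorial components in
`supp`; BK-1 NOT included — lens-2 books BK-1 separately, census §8.3 (ii)). Implied by `InsertionStableMarkedOrderReductionThree`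
(`of_marked` below). The equal-characteristic binder (crit-1 TRIAGE 28 F1) is again left to the prover. [cite: CossartPiltant2008, Prop. 4.4] -/
def InsertionStableOrderReductionThreeCodimTwo : Prop :=
  ∃ ρ : ∀ (X : Scheme.{u}), MarkedIdeal X → X.IdealSheafData,
    (∀ (X : Scheme.{u}) (M : MarkedIdeal X), IsNormalisedThreefoldStateCodimTwo X M → M.support.Nonempty →
        AdmissibleCentre M (ρ X M)) ∧
    ∀ (Xs : ℕ → Scheme.{u}) (Ms : ∀ n, MarkedIdeal (Xs n)) (π : ∀ n, Xs (n + 1) ⟶ Xs n)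
      (C : ∀ n, (Xs n).IdealSheafData) (P : ∀ n, (Xs n).IdealSheafData) (x : ∀ n, Xs n) (acc : ℕ → Prop),
      IsNormalisedThreefoldStateCodimTwo (Xs 0) (Ms 0) →
      (∀ n, (Ms n).support.Nonempty) →
      P 0 = ρ (Xs 0) (Ms 0) →
      (∀ n, IsBlowup (π n) (C n)) →
      (∀ n, AdmissibleCentre (Ms n) (C n)) →
      (∀ n, Ms (n + 1) = (Ms n).transform (π n) (C n)) →
      (∀ n, acc n → C n = P n ∧ P (n + 1) = ρ (Xs (n + 1)) (Ms (n + 1))) →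
      (∀ n, ¬ acc n →
          IsClosed ({x n} : Set (Xs n)) ∧ x n ∈ (P n).support ∧ x n ∈ (Ms n).support ∧
          ((C n).support : Set (Xs n)) = {x n} ∧
          P (n + 1) = strictTransformIdeal (π n) (C n) (P n)) →
      (∀ n, ∃ m, n ≤ m ∧ acc m) →
      False

/-- The Cutkosky-form statement implies the X44c-minimal one (more hypotheses on the states, same rule). [folklore] -/
theorem InsertionStableOrderReductionThreeCodimTwo.of_marked (h : InsertionStableMarkedOrderReductionThree.{u}) :
    InsertionStableOrderReductionThreeCodimTwo.{u} := by
  obtain ⟨ρ, hR, hT⟩ := h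
  refine ⟨ρ, fun X M hXM hne => hR X M hXM.1 hne, ?_⟩
  intro Xs Ms π C P x acc h0 hne hP0 hbl hadm htr hacc hins hbound
  exact hT Xs Ms π C P x acc h0.1 hne hP0 hbl hadm htr hacc hins hbound

end Summit.ResolutionOfSingularities.ResolutionOfSingularities.Cruxes.DescentPerfectToAll.GiraudWeakNormalForm

end
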